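import Literature.AlgebraicGeometry.Motives.LinesGenerateChowOneProofs
import Literature.AlgebraicGeometry.Motives.AlgebraicEquivalence

/-!
# Reduction of "`CH₁(X)` is generated by lines" to algebraic equivalence (Tian–Zong, Lemma 3.4)

Z. Tian, H. R. Zong, *One-cycles on rationally connected varieties*, Compositio Math. **150** (2014),
§3 and §6 [TianZong2014]. The proof of Thm. 6.1 (= Thm. 1.7, the named fact
`TianZong2014_chowOne_generatedByLines`) runs (p. 9 of arXiv:1209.4342):

> By the assumption, `X` is rationally chain connected by chains of lines […]. Then
> * `CH₀(F(X)) ⊗ ℚ → CH₁(X) ⊗ ℚ` is surjective (Proposition 3.13.3, Chap. IV [Kollár]);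
> * the cokernel of `CH₀(F(X))_alg → CH₁(X)_alg` is annihilated by an integer `N`
>   (c.f. Proposition 3.1).
> Thus it suffices to show that every curve is algebraically equivalent to an integral sum of
> lines by the same argument as in Lemma 3.4.

and Lemma 3.4 ("it suffices to prove that rational curves generate the group of one cycles modulo
algebraic equivalence") is proved from Prop. 3.1 (a uniform integer `N` with `N · D ∼ Σ mᵢ Fᵢ` for
every `1`-cycle `D`) and Lemma 3.2 (= Bloch–Ogus, Lemma 7.10: `CH₁(X)_alg` is a divisible group):
if `[C] - Σ nᵢ [Cᵢ] = x ∈ CH₁(X)_alg`, write `x = N · y` with `y ∈ CH₁(X)_alg` and use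
`N · y ∈ ⟨lines⟩`.

This file proves that reduction on the tree's carriers, for an arbitrary embedded `k`-scheme
`i : X ⟶ ℙᴺ_k` (`theorem ofPoint_mem_closure_lineClasses_of_algTrivial`,
`chowOneGeneratedByLines_of_algTrivial`): **if** (N) some positive integer `N` multiplies every class
of `CH₁(X)` into the subgroup generated by the line classes, (D) the image of `Alg₁(X)`
(`algTrivial X 1`, `Motives/AlgebraicEquivalence`) in `CH₁(X)` is divisible, and (G) every integral
curve on `X` is algebraically equivalent to an integral combination of lines, **then** `CH₁(X)` is
generated by lines (`ChowOneGeneratedByLines N i`); and the corresponding conditional form of the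
named fact (`TianZong2014_chowOne_generatedByLines_of_algTrivial`). For the complete intersections of
the fact, (N) with a NON-uniform integer is `exists_pos_smul_mem_closure_lineClasses_of_sum_deg_le`
(`Motives/LinesGenerateChowOneRationalAll`); the uniform integer is Kollár IV.3.13.3 / Tian–Zong
Prop. 3.1; (D) is Lemma 3.2 (Jacobians of curves); (G) is Thm. 1.3 with Thm. 6.2 of the paper.

## References

* [TianZong2014] Z. Tian, H. R. Zong, *One-cycles on rationally connected varieties*, Compositio
  Math. 150 (2014) 396–408, arXiv:1209.4342: Prop. 3.1, Lemma 3.2, Cor. 3.3, Lemma 3.4 (p. 6),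
  proof of Thm. 6.1 (p. 9).
* S. Bloch, A. Ogus, *Gersten's conjecture and the homology of schemes*, Ann. Sci. ÉNS 7 (1974),
  Lemma 7.10.
-/

noncomputable section

open CategoryTheory AlgebraicGeometry Order

universe u

namespace Literature.AlgebraicGeometry.Motives

section Reduction

variable {k : Type u} [Field k] {N : ℕ} {X : SchemeOver k} {i : X ⟶ projectiveSpace N k}

/-- **Tian–Zong, Lemma 3.4 / Cor. 3.3 (pointwise form).** Let `i : X ⟶ ℙᴺ_k`. Assume:
(N) a positive integer `Nu` with `Nu • x ∈ ⟨line classes⟩` for every `x ∈ CH₁(X)`;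
(D) the image of `Alg₁(X)` in `CH₁(X)` is divisible: every `a ∈ Alg₁(X)` is rationally equivalent to
`m • b` with `b ∈ Alg₁(X)`, for every `m > 0`;
(G) every integral curve `closure {z}` is algebraically equivalent to an integral combination of
lines. Then the class of every integral curve lies in the subgroup of `CH₁(X)` generated by the line
classes: with `[z] - Σ w_y [y] = a = Nu • b`, `Nu • [b]` is a combination of lines by (N).
[cite: TianZong2014, Lemma 3.4 and Cor. 3.3 (p. 6); proof of Thm. 6.1 (p. 9)] -/
theorem ofPoint_mem_closure_lineClasses_of_algTrivial
    (hN : ∃ Nu : ℕ, 0 < Nu ∧ ∀ x : ChowGroup X.left 1,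
      (Nu : ℤ) • x ∈ AddSubgroup.closure (lineClasses N i))
    (hdiv : ∀ a ∈ algTrivial X 1, ∀ m : ℕ, 0 < m →
      ∃ b ∈ algTrivial X 1, IsRationallyEquivalent a ((m : ℤ) • b) 1)
    (hgen : ∀ z : ↥X.left, height z = 1 → ∃ (s : Finset ↥X.left) (w : ↥X.left → ℤ),
      (∀ y ∈ s, IsLinePoint N i y) ∧
        primeCycle z - ∑ y ∈ s, w y • primeCycle y ∈ algTrivial X 1)
    (z : ↥X.left) (hz : height z = ((1 : ℕ) : ℕ∞)) :
    ChowGroup.ofPoint z hz ∈ AddSubgroup.closure (lineClasses N i) := by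
  obtain ⟨Nu, hNu, hNx⟩ := hN
  obtain ⟨s, w, hs, ha⟩ := hgen z (by simpa using hz)
  set a : AlgebraicCycle X.left ℤ := primeCycle z - ∑ y ∈ s, w y • primeCycle y with ha_def
  obtain ⟨b, hb, hab⟩ := hdiv a ha Nu hNu
  have ha1 : a ∈ cyclesOfDim X.left 1 := algTrivial_le_cyclesOfDim X 1 ha
  have hb1 : b ∈ cyclesOfDim X.left 1 := algTrivial_le_cyclesOfDim X 1 hb
  have hsum1 : (∑ y ∈ s, w y • primeCycle y) ∈ cyclesOfDim X.left 1 :=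
    sum_zsmul_primeCycle_mem_cyclesOfDim w hs
  -- `[a] = Nu • [b] ∈ ⟨lines⟩`
  have hmka : ChowGroup.mk X.left 1 ⟨a, ha1⟩ =
      (Nu : ℤ) • ChowGroup.mk X.left 1 ⟨b, hb1⟩ := by
    rw [← map_zsmul]
    exact ChowGroup.mk_eq_mk_iff.mpr hab
  have hamem : ChowGroup.mk X.left 1 ⟨a, ha1⟩ ∈ AddSubgroup.closure (lineClasses N i) := by
    rw [hmka]; exact hNx _
  -- `[z] = [a] + [Σ w_y y]`
  have hsplit : ChowGroup.ofPoint z hz =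
      ChowGroup.mk X.left 1 ⟨a, ha1⟩ + ChowGroup.mk X.left 1 ⟨_, hsum1⟩ := by
    rw [← map_add]
    simp only [ChowGroup.ofPoint]
    congr 1
    exact Subtype.ext (by simp [ha_def])
  rw [hsplit]
  exact AddSubgroup.add_mem _ hamem (mk_sum_zsmul_primeCycle_mem_closure_lineClasses w hs)

/-- **Tian–Zong, Lemma 3.4 (global form): generation by lines modulo algebraic equivalence, a
uniform torsion exponent for `CH₁(X)/⟨lines⟩` and divisibility of the image of `Alg₁(X)` imply that
`CH₁(X)` is generated by lines** (on a compact `X`, where `CH₁` is generated by classes of curves).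
[cite: TianZong2014, Lemma 3.4 (p. 6) and proof of Thm. 6.1 (p. 9)] -/
theorem chowOneGeneratedByLines_of_algTrivial [CompactSpace ↥X.left]
    (hN : ∃ Nu : ℕ, 0 < Nu ∧ ∀ x : ChowGroup X.left 1,
      (Nu : ℤ) • x ∈ AddSubgroup.closure (lineClasses N i))
    (hdiv : ∀ a ∈ algTrivial X 1, ∀ m : ℕ, 0 < m →
      ∃ b ∈ algTrivial X 1, IsRationallyEquivalent a ((m : ℤ) • b) 1)
    (hgen : ∀ z : ↥X.left, height z = 1 → ∃ (s : Finset ↥X.left) (w : ↥X.left → ℤ),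
      (∀ y ∈ s, IsLinePoint N i y) ∧
        primeCycle z - ∑ y ∈ s, w y • primeCycle y ∈ algTrivial X 1) :
    ChowOneGeneratedByLines N i :=
  chowOneGeneratedByLines_of_closure_lineClasses_eq_top
    (closure_lineClasses_eq_top_of_forall_ofPoint_mem
      (ofPoint_mem_closure_lineClasses_of_algTrivial hN hdiv hgen))

end Reduction

/-- **The named fact `TianZong2014_chowOne_generatedByLines`, conditionally on the inputs of §§3, 5, 6
of the paper** (the reduction of the proof of Thm. 6.1 to its three ingredients, proved): if for
every smooth complete intersection `X ⊆ ℙⁿ⁺ᶜ_k` of the fact (N) a positive integer multiplies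
`CH₁(X)` into the subgroup generated by lines (Kollár IV.3.13.3 / Prop. 3.1; with a non-uniform
integer this is `exists_pos_smul_mem_closure_lineClasses_of_sum_deg_le`), (D) the image of
`Alg₁(X)` in `CH₁(X)` is divisible (Lemma 3.2, Bloch–Ogus 7.10) and (G) every integral curve is
algebraically equivalent to an integral combination of lines (Thm. 1.3 with Thm. 6.2), then the
fact holds. [cite: TianZong2014, Lemma 3.4 and proof of Thm. 6.1 (p. 9)] -/
theorem TianZong2014_chowOne_generatedByLines_of_algTrivial
    (h : ∀ ⦃k : Type u⦄ [Field k] [IsAlgClosed k] [CharZero k] ⦃c : ℕ⦄ (n : ℕ) (d : Fin c → ℕ)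
      ⦃X : SchemeOver k⦄ (F : Fin c → MvPolynomial (Fin (n + c + 1)) k)
      (i : X ⟶ projectiveSpace (n + c) k),
      letI := MvPolynomial.gradedAlgebra (σ := Fin (n + c + 1)) (R := k)
      IsSmoothProjective n X → (∀ a, (F a).IsHomogeneous (d a)) → (∀ a, 0 < d a) →
        IsNonsingularSystem k F → IsClosedImmersion i.left →
          Set.range i.left.base =
            ProjectiveSpectrum.zeroLocus (MvPolynomial.homogeneousSubmodule (Fin (n + c + 1)) k)
              (Set.range F) →
            (∑ a, d a) + 1 ≤ n + c →
              (∃ Nu : ℕ, 0 < Nu ∧ ∀ x : ChowGroup X.left 1,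
                (Nu : ℤ) • x ∈ AddSubgroup.closure (lineClasses (n + c) i)) ∧
              (∀ a ∈ algTrivial X 1, ∀ m : ℕ, 0 < m →
                ∃ b ∈ algTrivial X 1, IsRationallyEquivalent a ((m : ℤ) • b) 1) ∧
              (∀ z : ↥X.left, height z = 1 → ∃ (s : Finset ↥X.left) (w : ↥X.left → ℤ),
                (∀ y ∈ s, IsLinePoint (n + c) i y) ∧
                  primeCycle z - ∑ y ∈ s, w y • primeCycle y ∈ algTrivial X 1)) :
    TianZong2014_chowOne_generatedByLines.{u} := by
  intro k _ _ _ c n d X F i hX hF hd hJ hi hV hdeg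
  haveI : CompactSpace ↥X.left := IsSmoothProjective.compactSpace_holds hX
  obtain ⟨hN, hdiv, hgen⟩ := h n d F i hX hF hd hJ hi hV hdeg
  exact chowOneGeneratedByLines_of_algTrivial hN hdiv hgen

end Literature.AlgebraicGeometry.Motives

end
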